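import Literature.Geometry.Lorentzian.CoordTensorNorm
import Literature.Geometry.Lorentzian.CoordCurvatureNormEvolution
import Literature.Geometry.Lorentzian.CoordHarmonicCurvature
import HarnessLib

/-!
# Symmetries and linearity of `∇²R` and `ΔR`; the Laplacian of the curvature of Einstein components

Continuation of `CoordCurvatureRicciIdentity.lean` / `CoordCurvatureLaplacian.lean`
(namespace `MetricCoord`: metric components `G`, `IsMetricOn G V`; `covRiemAt` (`∇R`),
`cov2RiemAt` (`∇²R`), `lapRiemAt G b` (`ΔR = Σ g^{kl} ∇²_{b_k,b_l}R`), `quadRiemAt G b` (`Rm * Rm`),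
Topping's Prop. 2.4.1 `IsMetricOn.apply_lapRiemAt`). Everything here is PROVED; no definition.

* **Linearity**: `covRiemAt` in its derivative slot (`covRiemAt_add_left`, `…_smul_left`);
  `cov2RiemAt` in its two derivative slots (`cov2RiemAt_add₁/₂`, `…_smul₁/₂`).
* **`∇²R` is an algebraic curvature tensor in its last slots**: `(∇²_{X,U}R)(Y,V)` lowered is skew
  in the output pair (`IsMetricOn.apply_cov2RiemAt_swap₃₄`), satisfies the first Bianchi identity
  (`IsMetricOn.cov2RiemAt_cyclic₂`: the cyclic sum of `(∇²_{X,U}R)(Y,V)Z`, from the covariantly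
  differentiated identity `covRiemAt_cyclic₂` — the Christoffel corrections regroup into three more
  instances of it) and pair symmetry (`IsMetricOn.apply_cov2RiemAt_pair_comm`); hence so does the
  rough Laplacian `ΔR` (`lapRiemAt_swap₁₂`, `apply_lapRiemAt_swap₃₄`, `lapRiemAt_cyclic₂`,
  `apply_lapRiemAt_pair_comm`) — O'Neill 1983, Ch. 3, Prop. 3.36 for `∇²R` and `ΔR`.
* **Einstein components** `Ric = λG` on `V`: `∇²Ric = 0` (`cov₃At_cov₂At_ricAt_eq_zero_of_einstein`)
  and Topping's formula reduces to **`G((ΔR)(X,Y)Z,W) = −Q(X,Y,Z,W) + Q(Y,X,Z,W)`**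
  (`IsMetricOn.apply_lapRiemAt_of_einstein`; Hamilton 1982, Lemma 7.2 / Topping 2006, Prop. 2.4.1 with
  `∇²Ric = 0`: the static curvature equation `ΔRm = −Rm * Rm + 2λ Rm`-type of an Einstein metric).
* **Traces in an orthonormal frame**: for a `G_x`-orthonormal basis `e`,
  `Σ_{kl} g^{kl} ∇²_{b_k,b_l} = Σ_c ∇²_{e_c,e_c}` (`lapRiemAt_eq_sum_frame`) and
  `quadRiemAt G b = quadRiemAt G e` read on the frame (`quadRiemAt_eq_sum_frame`), so that `ΔR` and
  `Q` in ANY basis `b` may be evaluated on the frame (`HamiltonReactionIdentity.lean`).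

## References

* P. Topping, *Lectures on the Ricci flow*, CUP 2006, §2.1, §2.4 (Prop. 2.4.1). [Topping2006]
* R. S. Hamilton, J. Differential Geom. 17 (1982), §7, Lemma 7.2. [Hamilton1982]
* B. O'Neill, *Semi-Riemannian geometry*, Academic Press 1983, Ch. 3, Prop. 3.36–3.37.
  [ONeill1983]
* A. L. Besse, *Einstein manifolds*, Springer 1987, 16.4 (`∇Ric = 0` for Einstein metrics). [Besse1987]
-/

noncomputable section

set_option maxSynthPendingDepth 3

open Set Filter ContinuousLinearMap Module Function
open scoped Topology ContDiff

namespace Literature.Geometry.Lorentzian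

namespace MetricCoord

variable {E : Type*} [NormedAddCommGroup E] [NormedSpace ℝ E] [FiniteDimensional ℝ E]
  [CompleteSpace E] {G : E → E →L[ℝ] E →L[ℝ] ℝ} {V : Set E} {x : E}

/-! ### Linearity in the derivative slots -/

section Linear

variable (hG : IsMetricOn G V) (hx : x ∈ V)
include hG hx

omit [FiniteDimensional ℝ E] in
/-- `(∇_W R)(Y,Z)` is additive in the derivative slot `W`. [folklore] -/
theorem IsMetricOn.covRiemAt_add_left (W₁ W₂ Y Z : E) :
    covRiemAt G x (W₁ + W₂) Y Z = covRiemAt G x W₁ Y Z + covRiemAt G x W₂ Y Z := by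
  simp only [hG.covRiemAt_eq_riemCLM hx, map_add, _root_.add_apply, ContinuousLinearMap.add_comp,
    ContinuousLinearMap.comp_add]
  abel

omit [FiniteDimensional ℝ E] in
/-- `(∇_W R)(Y,Z)` is homogeneous in `W`. [folklore] -/
theorem IsMetricOn.covRiemAt_smul_left (c : ℝ) (W Y Z : E) :
    covRiemAt G x (c • W) Y Z = c • covRiemAt G x W Y Z := by
  simp only [hG.covRiemAt_eq_riemCLM hx, map_smul, _root_.smul_apply, ContinuousLinearMap.smul_comp,
    ContinuousLinearMap.comp_smul, smul_sub, smul_add]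

omit [FiniteDimensional ℝ E] in
/-- `(∇²_{X,U} R)(Y,V)` is additive in `X`. [folklore] -/
theorem IsMetricOn.cov2RiemAt_add₁ (X₁ X₂ U Y W : E) :
    cov2RiemAt G x (X₁ + X₂) U Y W = cov2RiemAt G x X₁ U Y W + cov2RiemAt G x X₂ U Y W := by
  simp only [cov2RiemAt_def, hG.fderiv_covRiemAt hx, map_add, _root_.add_apply,
    ContinuousLinearMap.add_comp, ContinuousLinearMap.comp_add, hG.covRiemAt_add_left hx,
    hG.covRiemAt_add_mid hx, hG.covRiemAt_add_right hx]
  abel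

omit [FiniteDimensional ℝ E] in
/-- `(∇²_{X,U} R)(Y,V)` is homogeneous in `X`. [folklore] -/
theorem IsMetricOn.cov2RiemAt_smul₁ (c : ℝ) (X U Y W : E) :
    cov2RiemAt G x (c • X) U Y W = c • cov2RiemAt G x X U Y W := by
  simp only [cov2RiemAt_def, hG.fderiv_covRiemAt hx, map_smul, _root_.smul_apply,
    ContinuousLinearMap.smul_comp, ContinuousLinearMap.comp_smul, hG.covRiemAt_smul_left hx,
    hG.covRiemAt_smul_mid hx, hG.covRiemAt_smul_right hx, smul_sub, smul_add]

omit [FiniteDimensional ℝ E] in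
/-- `(∇²_{X,U} R)(Y,V)` is additive in `U`. [folklore] -/
theorem IsMetricOn.cov2RiemAt_add₂ (X U₁ U₂ Y W : E) :
    cov2RiemAt G x X (U₁ + U₂) Y W = cov2RiemAt G x X U₁ Y W + cov2RiemAt G x X U₂ Y W := by
  simp only [cov2RiemAt_def, hG.fderiv_covRiemAt hx, map_add, _root_.add_apply,
    ContinuousLinearMap.add_comp, ContinuousLinearMap.comp_add, hG.covRiemAt_add_left hx]
  abel

omit [FiniteDimensional ℝ E] in
/-- `(∇²_{X,U} R)(Y,V)` is homogeneous in `U`. [folklore] -/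
theorem IsMetricOn.cov2RiemAt_smul₂ (c : ℝ) (X U Y W : E) :
    cov2RiemAt G x X (c • U) Y W = c • cov2RiemAt G x X U Y W := by
  simp only [cov2RiemAt_def, hG.fderiv_covRiemAt hx, map_smul, _root_.smul_apply,
    ContinuousLinearMap.smul_comp, ContinuousLinearMap.comp_smul, hG.covRiemAt_smul_left hx,
    smul_sub, smul_add]

end Linear

/-! ### `∇²R` has the symmetries of an algebraic curvature tensor -/

section Symm

variable (hG : IsMetricOn G V) (hx : x ∈ V)
include hG hx

omit [FiniteDimensional ℝ E] in
/-- **`G((∇²_{X,U}R)(Y,V)W, Z) = −G((∇²_{X,U}R)(Y,V)Z, W)`** (metric compatibility; O'Neill 1983,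
Ch. 3, Prop. 3.36 (2) for `∇²R`). [cite: ONeill1983, Ch. 3, Prop. 3.36] -/
theorem IsMetricOn.apply_cov2RiemAt_swap₃₄ (X U Y W Z T : E) :
    G x (cov2RiemAt G x X U Y W T) Z = -G x (cov2RiemAt G x X U Y W Z) T := by
  rw [hG.apply_cov2RiemAt hx, hG.apply_cov2RiemAt hx]
  have hs := fun A B C Z' T' ↦ hG.apply_covRiemAt_swap hx A B C Z' T'
  have heq : (fun y ↦ G y (covRiemAt G y U Y W T) Z) =ᶠ[𝓝 x] fun y ↦ -G y (covRiemAt G y U Y W Z) T :=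
    (hG.eventually_mem hx).mono fun y hy ↦ hG.apply_covRiemAt_swap hy U Y W Z T
  rw [heq.fderiv_eq, fderiv_fun_neg, _root_.neg_apply, hs (chrAt G x X U) Y W Z T,
    hs U (chrAt G x X Y) W Z T, hs U Y (chrAt G x X W) Z T, hs U Y W (chrAt G x X T) Z,
    hs U Y W Z (chrAt G x X T), hs U Y W (chrAt G x X Z) T]
  ring

omit [FiniteDimensional ℝ E] in
/-- **The first Bianchi identity for `∇²R`**:
`(∇²_{X,U}R)(Y,V)Z + (∇²_{X,U}R)(V,Z)Y + (∇²_{X,U}R)(Z,Y)V = 0`. Differentiate the identity for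
`∇R` (`covRiemAt_cyclic₂`, valid near `x`) along `X`; the Christoffel corrections of the three
slots and of the output regroup into the instances of the same identity with `Γ_X Y`, `Γ_X V`,
`Γ_X Z` inserted. [cite: ONeill1983, Ch. 3, Prop. 3.36] -/
theorem IsMetricOn.cov2RiemAt_cyclic₂ (X U Y W Z : E) :
    cov2RiemAt G x X U Y W Z + cov2RiemAt G x X U W Z Y + cov2RiemAt G x X U Z Y W = 0 := by
  -- derivative of the vanishing cyclic sum, applied
  have hd : ∀ A B C : E, DifferentiableAt ℝ (fun y ↦ covRiemAt G y U A B C) x := fun A B C ↦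
    differentiableAt_clm_apply_const (hG.differentiableAt_covRiemAt hx U A B) C
  have hzero : (fun y ↦ covRiemAt G y U Y W Z + covRiemAt G y U W Z Y + covRiemAt G y U Z Y W) =ᶠ[𝓝 x]
      fun _ ↦ (0 : E) :=
    (hG.eventually_mem hx).mono fun y hy ↦ hG.covRiemAt_cyclic₂ hy U Y W Z
  have hD : fderiv ℝ (fun y ↦ covRiemAt G y U Y W) x X Z + fderiv ℝ (fun y ↦ covRiemAt G y U W Z) x X Y +
      fderiv ℝ (fun y ↦ covRiemAt G y U Z Y) x X W = 0 := by
    have hdf : ∀ A B C : E, HasFDerivAt (fun y ↦ covRiemAt G y U A B C)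
        (fderiv ℝ (fun y ↦ covRiemAt G y U A B C) x) x := fun A B C ↦ (hd A B C).hasFDerivAt
    have hsumd := ((hdf Y W Z).fun_add (hdf W Z Y)).fun_add (hdf Z Y W)
    have h := hsumd.fderiv
    rw [hzero.fderiv_eq, fderiv_fun_const] at h
    have hK := congrArg (fun T : E →L[ℝ] E ↦ T X) h
    simp only [Pi.zero_apply, _root_.zero_apply, _root_.add_apply] at hK
    rw [hG.fderiv_covRiemAt_apply hx, hG.fderiv_covRiemAt_apply hx, hG.fderiv_covRiemAt_apply hx] at hK
    exact hK.symm
  -- instances of the identity for `∇R`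
  have c0 := hG.covRiemAt_cyclic₂ hx U Y W Z
  have cU := hG.covRiemAt_cyclic₂ hx (chrAt G x X U) Y W Z
  have cY := hG.covRiemAt_cyclic₂ hx U (chrAt G x X Y) W Z
  have cW := hG.covRiemAt_cyclic₂ hx U Y (chrAt G x X W) Z
  have cZ := hG.covRiemAt_cyclic₂ hx U Y W (chrAt G x X Z)
  have cL : chrAt G x X (covRiemAt G x U Y W Z + covRiemAt G x U W Z Y + covRiemAt G x U Z Y W) = 0 := by
    rw [c0, map_zero]
  rw [map_add, map_add] at cL
  simp only [cov2RiemAt_def, _root_.add_apply, _root_.sub_apply, ContinuousLinearMap.comp_apply]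
  linear_combination (norm := abel_nf) hD + cL - cU - cY - cW - cZ

omit [FiniteDimensional ℝ E] in
/-- **Pair symmetry of `∇²R`**: `G((∇²_{X,U}R)(Y,V)Z, T) = G((∇²_{X,U}R)(Z,T)Y, V)`
(`pair_comm_of_skew_of_cyclic`). [cite: ONeill1983, Ch. 3, Prop. 3.36] -/
theorem IsMetricOn.apply_cov2RiemAt_pair_comm (X U Y W Z T : E) :
    G x (cov2RiemAt G x X U Y W Z) T = G x (cov2RiemAt G x X U Z T Y) W :=
  pair_comm_of_skew_of_cyclic (fun Y W Z T ↦ G x (cov2RiemAt G x X U Y W Z) T)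
    (fun Y W Z T ↦ by rw [cov2RiemAt_swap, _root_.neg_apply, map_neg, _root_.neg_apply])
    (fun Y W Z T ↦ hG.apply_cov2RiemAt_swap₃₄ hx X U Y W Z T)
    (fun Y W Z T ↦ by
      rw [← _root_.add_apply, ← _root_.add_apply, ← map_add, ← map_add,
        hG.cov2RiemAt_cyclic₂ hx X U Y W Z, map_zero, _root_.zero_apply])
    Y W Z T

variable {ι : Type*} [Fintype ι] (b : Basis ι ℝ E)

omit [CompleteSpace E] hG hx in
/-- `G((ΔR)(X,Y)Z, W) = Σ_{kl} g^{kl} G((∇²_{b_k,b_l}R)(X,Y)Z, W)`. [cite: Topping2006, §2.4, (2.4.1)] -/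
theorem apply_lapRiemAt_eq_sum (X Y Z W : E) :
    G x (lapRiemAt G b x X Y Z) W = ∑ k, ∑ l, ginv G b x k l * G x (cov2RiemAt G x (b k) (b l) X Y Z) W := by
  unfold lapRiemAt
  simp only [_root_.sum_apply, _root_.smul_apply, map_sum, map_smul, smul_eq_mul]

omit [CompleteSpace E] hG hx in
/-- `(ΔR)(Y,X) = −(ΔR)(X,Y)`. [cite: ONeill1983, Ch. 3, Prop. 3.36] -/
theorem lapRiemAt_swap₁₂ (X Y : E) : lapRiemAt G b x Y X = -lapRiemAt G b x X Y := by
  unfold lapRiemAt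
  rw [← Finset.sum_neg_distrib]
  refine Finset.sum_congr rfl fun k _ ↦ ?_
  rw [← Finset.sum_neg_distrib]
  refine Finset.sum_congr rfl fun l _ ↦ ?_
  rw [cov2RiemAt_swap, smul_neg]

/-- `G((ΔR)(X,Y)W, Z) = −G((ΔR)(X,Y)Z, W)`. [cite: ONeill1983, Ch. 3, Prop. 3.36] -/
theorem IsMetricOn.apply_lapRiemAt_swap₃₄ (X Y Z T : E) :
    G x (lapRiemAt G b x X Y T) Z = -G x (lapRiemAt G b x X Y Z) T := by
  rw [apply_lapRiemAt_eq_sum, apply_lapRiemAt_eq_sum, ← Finset.sum_neg_distrib]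
  refine Finset.sum_congr rfl fun k _ ↦ ?_
  rw [← Finset.sum_neg_distrib]
  refine Finset.sum_congr rfl fun l _ ↦ ?_
  rw [hG.apply_cov2RiemAt_swap₃₄ hx, mul_neg]

/-- The first Bianchi identity for `ΔR`. [cite: ONeill1983, Ch. 3, Prop. 3.36] -/
theorem IsMetricOn.lapRiemAt_cyclic₂ (X Y Z : E) :
    lapRiemAt G b x X Y Z + lapRiemAt G b x Y Z X + lapRiemAt G b x Z X Y = 0 := by
  unfold lapRiemAt
  simp only [_root_.sum_apply, _root_.smul_apply, ← Finset.sum_add_distrib, ← smul_add,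
    hG.cov2RiemAt_cyclic₂ hx, smul_zero, Finset.sum_const_zero]

/-- Pair symmetry of `ΔR`: `G((ΔR)(X,Y)Z, T) = G((ΔR)(Z,T)X, Y)`. [cite: ONeill1983, Ch. 3, Prop. 3.36] -/
theorem IsMetricOn.apply_lapRiemAt_pair_comm (X Y Z T : E) :
    G x (lapRiemAt G b x X Y Z) T = G x (lapRiemAt G b x Z T X) Y := by
  rw [apply_lapRiemAt_eq_sum, apply_lapRiemAt_eq_sum]
  exact Finset.sum_congr rfl fun k _ ↦ Finset.sum_congr rfl fun l _ ↦ by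
    rw [hG.apply_cov2RiemAt_pair_comm hx _ _ X Y Z T]

end Symm

/-! ### Einstein components: `∇²Ric = 0` and `ΔR = −Q + Qᵗ` -/

section Einstein

variable (hG : IsMetricOn G V) (hx : x ∈ V) {lam : ℝ} (hE : ∀ y ∈ V, ricAt G y = lam • G y)
include hG hx hE

omit [CompleteSpace E] in
/-- **`∇²Ric = 0` for Einstein components** (`∇Ric = 0` on the open set `V`,
`cov₂At_ricAt_of_einstein`). [cite: Besse1987, 16.4] -/
theorem IsMetricOn.cov₃At_cov₂At_ricAt_eq_zero_of_einstein : cov₃At G (cov₂At G (ricAt G)) x = 0 := by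
  have hev : cov₂At G (ricAt G) =ᶠ[𝓝 x] fun _ ↦ (0 : E →L[ℝ] E →L[ℝ] E →L[ℝ] ℝ) :=
    (hG.eventually_mem hx).mono fun y hy ↦ hG.cov₂At_ricAt_of_einstein hy hE
  rw [cov₃At_congr hev]
  ext W A B C
  simp [cov₃At_apply]

variable {ι : Type*} [Fintype ι] (b : Basis ι ℝ E)

/-- **The Laplacian of the curvature of Einstein components** (Topping 2006, Prop. 2.4.1 with
`∇²Ric = 0`; Hamilton 1982, Lemma 7.2): `G((ΔR)(X,Y)Z, W) = −Q(X,Y,Z,W) + Q(Y,X,Z,W)` with the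
quadratic expression `Q = quadRiemAt G b` (`Rm * Rm`). [cite: Topping2006, Prop. 2.4.1]
[cite: Hamilton1982, §7, Lemma 7.2] -/
theorem IsMetricOn.apply_lapRiemAt_of_einstein (X Y Z W : E) :
    G x (lapRiemAt G b x X Y Z) W = -quadRiemAt G b x X Y Z W + quadRiemAt G b x Y X Z W := by
  rw [hG.apply_lapRiemAt b hx, hG.cov₃At_cov₂At_ricAt_eq_zero_of_einstein hx hE]
  simp

end Einstein

/-! ### Metric traces in an orthonormal frame -/

section Frame

variable {ι : Type*} [Fintype ι] (b : Basis ι ℝ E) {κ : Type*} [Fintype κ] [DecidableEq κ]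
  (e : Basis κ ℝ E) (he : ∀ c d, G x (e c) (e d) = if c = d then 1 else 0)
include he

omit [CompleteSpace E] in
/-- **A metric trace is a sum over an orthonormal frame**: for `Φ` bilinear,
`Σ_{kl} g^{kl} Φ(b_k, b_l) = Σ_c Φ(e_c, e_c)` (`g^{kl} = Σ_c bᵏ(e_c) bˡ(e_c)`).
[cite: ONeill1983, Ch. 3, pp. 60–61] -/
theorem sum_ginv_smul_eq_sum_frame {F : Type*} [AddCommGroup F] [Module ℝ F]
    (hi : (G x).IsInvertible) (hs : ∀ v w : E, G x v w = G x w v) (Φ : E →ₗ[ℝ] E →ₗ[ℝ] F) :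
    ∑ k, ∑ l, ginv G b x k l • Φ (b k) (b l) = ∑ c, Φ (e c) (e c) := by
  have hexp : ∀ c, Φ (e c) (e c) = ∑ k, ∑ l, (b.coord k (e c) * b.coord l (e c)) • Φ (b k) (b l) := by
    intro c
    have h1 : Φ (e c) (e c) = ∑ k, b.repr (e c) k • Φ (b k) (e c) := by
      nth_rewrite 1 [← b.sum_repr (e c)]
      rw [map_sum, LinearMap.sum_apply]
      exact Finset.sum_congr rfl fun k _ ↦ by rw [map_smul, LinearMap.smul_apply]
    rw [h1]
    refine Finset.sum_congr rfl fun k _ ↦ ?_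
    nth_rewrite 2 [← b.sum_repr (e c)]
    rw [map_sum, Finset.smul_sum]
    refine Finset.sum_congr rfl fun l _ ↦ ?_
    rw [map_smul, smul_smul, Basis.coord_apply, Basis.coord_apply]
  simp only [hexp, ginv_eq_sum_coord_frame b e he hi hs, Finset.sum_smul]
  refine Eq.symm ?_
  rw [Finset.sum_comm]
  exact Finset.sum_congr rfl fun k _ ↦ Finset.sum_comm

/-- **`ΔR` on an orthonormal frame**: `(ΔR)(X,Y) = Σ_c (∇²_{e_c,e_c}R)(X,Y)` for every basis `b`.
[cite: Topping2006, §2.4, (2.4.1)] -/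
theorem IsMetricOn.lapRiemAt_eq_sum_frame (hG : IsMetricOn G V) (hx : x ∈ V) (X Y : E) :
    lapRiemAt G b x X Y = ∑ c, cov2RiemAt G x (e c) (e c) X Y := by
  have hi := hG.isInvertible x hx
  have hs := hG.symm x hx
  let Φ : E →ₗ[ℝ] E →ₗ[ℝ] (E →L[ℝ] E) := LinearMap.mk₂ ℝ (fun u v ↦ cov2RiemAt G x u v X Y)
    (fun u u' v ↦ hG.cov2RiemAt_add₁ hx u u' v X Y) (fun c u v ↦ hG.cov2RiemAt_smul₁ hx c u v X Y)
    (fun u v v' ↦ hG.cov2RiemAt_add₂ hx u v v' X Y) (fun c u v ↦ hG.cov2RiemAt_smul₂ hx c u v X Y)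
  have h := sum_ginv_smul_eq_sum_frame b e he hi hs Φ
  unfold lapRiemAt
  simpa only [Φ, LinearMap.mk₂_apply] using h

omit [CompleteSpace E] in
/-- **`Q` on an orthonormal frame**: the quadratic expression `quadRiemAt G b` of any basis `b` equals
the one of the orthonormal basis `e` (both are the metric trace of the same bilinear expression).
[cite: Topping2006, §2.4, (2.4.2)] -/
theorem IsMetricOn.quadRiemAt_eq_of_orthonormal (hG : IsMetricOn G V) (hx : x ∈ V) (X Y Z W : E) :
    quadRiemAt G b x X Y Z W = quadRiemAt G e x X Y Z W := by
  have hi := hG.isInvertible x hx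
  have hs := hG.symm x hx
  let Φ : E →ₗ[ℝ] E →ₗ[ℝ] ℝ := LinearMap.mk₂ ℝ
    (fun u v ↦ G x (((riemAt G x u X).comp (riemAt G x Y v) - (riemAt G x Y v).comp (riemAt G x u X)
      - riemAt G x (riemAt G x u X Y) v - riemAt G x Y (riemAt G x u X v)) Z) W)
    (fun u u' v ↦ by
      simp only [riemAt_add_left, riemAt_add_right, map_add, map_sub, ContinuousLinearMap.add_comp,
        ContinuousLinearMap.comp_add, _root_.add_apply, _root_.sub_apply, ContinuousLinearMap.comp_apply]
      ring)
    (fun c u v ↦ by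
      simp only [riemAt_smul_left, riemAt_smul_right, map_smul, map_sub, ContinuousLinearMap.smul_comp,
        ContinuousLinearMap.comp_smul, _root_.smul_apply, _root_.sub_apply, ContinuousLinearMap.comp_apply,
        smul_eq_mul]
      ring)
    (fun u v v' ↦ by
      simp only [riemAt_add_right, map_add, map_sub, ContinuousLinearMap.add_comp,
        ContinuousLinearMap.comp_add, _root_.add_apply, _root_.sub_apply, ContinuousLinearMap.comp_apply]
      ring)
    (fun c u v ↦ by
      simp only [riemAt_smul_right, map_smul, map_sub, ContinuousLinearMap.smul_comp,
        ContinuousLinearMap.comp_smul, _root_.smul_apply, _root_.sub_apply, ContinuousLinearMap.comp_apply,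
        smul_eq_mul]
      ring)
  have h1 := sum_ginv_smul_eq_sum_frame b e he hi hs Φ
  have h2 := sum_ginv_smul_eq_sum_frame e e he hi hs Φ
  simp only [Φ, LinearMap.mk₂_apply, smul_eq_mul] at h1 h2
  rw [quadRiemAt, quadRiemAt, h1, h2]

end Frame

end MetricCoord

end Literature.Geometry.Lorentzian

end
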